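import Summits.CriticalPhenomena.PercolationContinuityZ3.Theorems.PercNearOneGluingNoHeavyLowerTailSahiTransportCheckCols
import Summits.CriticalPhenomena.PercolationContinuityZ3.Theorems.PercNearOneGluingNoHeavyLowerTailSahiHittingSlotPrelim
import Summits.CriticalPhenomena.PercolationContinuityZ3.Theorems.PercNearOneGluingNoHeavyLowerTailSahiC3CubeEvents

/-!
# `NoHeavyLowerTail` (crux stmt-CriticalPhenomena-4575), Sahi / Kahn positivity: the pattern cube `2^3` — codes, bitmask events and the
# polynomial dictionary linking `pr` on `Set (Set (Fin 3))` to the checked bitmask polynomials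

Support file (cell `prim-l12`, seat P3, gen 4; `--supports stmt-CriticalPhenomena-4575`).  No `sorry`, no named facts, standard axioms.

Plumbing between the two languages in which the transport certificates live:
* the ABSTRACT side (`…SahiTransportCert`): patterns `S : Set (Fin 3)`, events `𝒳 : Set (Set (Fin 3))`, the product weight `bernoulliWeight q`
  and probabilities `pr q 𝒳`;
* the CHECKED side (`…SahiTransportCheck`, `…SahiTransportCheckCols`): bitmasks `< 256`, tables `tabZ 3 T`, polynomials `mlT T x = ML (tabR 3 T) x`.
Contents: `code S` (the bitmask position of a pattern, `pt 3 (code S) = S`), the bitmask events `HkM M = {S | bit (code S) of M}`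
(`(HkM 232)ᶜ = HkM 23`, `(HkM 234)ᶜ = HkM 21`), `pr q 𝒴 = mlT (encA 3 𝒴) (xq q)` and its versions for intersections with `HkM M`, sums over
`Set (Fin 3)` as sums over the eight codes, `bernoulliWeight q (pt 3 j)` and `mlT 2^j` as the same monomial, the gate of `…SahiTransportCheck` as an
indicator, and the linear table identities `mlT 232 = mlT 8 + mlT 32 + mlT 64 + mlT 128` etc. [this work]
-/

noncomputable section

open scoped Classical

namespace Summit.CriticalPhenomena.PercolationContinuityZ3.Theorems

namespace SahiJuntaSlotThree

open Finset
open SahiHittingSlot SahiTransportCheck SahiC3Cube OneCutCert CovTransferCert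
open Literature.Combinatorics.Sahi2008
open Literature.Probability.Percolation.BHK2006 (weight)
open Literature.Probability.Percolation.DecisionTree (ind ind_of_mem ind_of_not_mem ind_nonneg)

/-! ### Real parameters of the pattern cube -/

/-- The parameters as a real point of `[0,1]³`. [this work] -/
def xq (q : Fin 3 → unitInterval) : Fin 3 → ℝ := fun i => (q i : ℝ)

/-- `xq q ∈ [0,1]³`. [this work] -/
theorem inCube_xq (q : Fin 3 → unitInterval) : InCube (xq q) := fun i => ⟨(q i).2.1, (q i).2.2⟩

/-- `mlT` is nonnegative on the cube (tables are `0/1`). [this work] -/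
theorem mlT_nonneg (T : ℕ) {x : Fin 3 → ℝ} (hx : InCube x) : 0 ≤ mlT T x := by
  unfold mlT tabR
  refine ML_nonneg (fun g => ?_) hx
  rw [tabZ_apply]; split_ifs <;> simp

/-- `mlT T ≤ 1` on the cube. [this work] -/
theorem mlT_le_one (T : ℕ) {x : Fin 3 → ℝ} (hx : InCube x) : mlT T x ≤ 1 := by
  unfold mlT ML tabR
  calc ∑ g, (tabZ 3 T g : ℝ) * mono x g ≤ ∑ g, mono x g := sum_le_sum fun g _ => by
          have h1 : (tabZ 3 T g : ℝ) ≤ 1 := by rw [tabZ_apply]; split_ifs <;> simp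
          have h0 := mono_nonneg hx g
          nlinarith
    _ = 1 := sum_mono x

/-! ### Codes of patterns -/

/-- The bit pattern of `S`. [this work] -/
def bits (S : Set (Fin 3)) : Fin 3 → Bool := fun i => decide (i ∈ S)

/-- `{i | bits S i} = S`. [this work] -/
theorem setOf_bits (S : Set (Fin 3)) : {i | bits S i = true} = S := by
  ext i; simp [bits]

/-- `bits` of a set given by a Boolean function. [this work] -/
theorem bits_setOf (g : Fin 3 → Bool) : bits {i | g i = true} = g := by
  funext i; simp [bits]

/-- The code (bitmask position, `< 8`) of a pattern. [this work] -/
def code (S : Set (Fin 3)) : ℕ := enc2 (bits S)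

/-- `code S < 8`. [this work] -/
theorem code_lt (S : Set (Fin 3)) : code S < 8 := by
  have h := enc2_lt (bits S); norm_num at h; exact h

/-- The code of a Boolean pattern is its corner position. [this work] -/
theorem code_setOf (g : Fin 3 → Bool) : code {i | g i = true} = enc2 g := by
  rw [code, bits_setOf]

/-- Decoding: `pt 3 (code S) = S`. [this work] -/
theorem pt_code (S : Set (Fin 3)) : pt 3 (code S) = S := by
  rw [code, pt_enc2, setOf_bits]

/-- Membership through the code. [this work] -/
theorem mem_iff_testBit_code (S : Set (Fin 3)) (i : Fin 3) : i ∈ S ↔ (code S).testBit i = true := by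
  conv_lhs => rw [← pt_code S]
  rfl

/-- The bits of `pt 3 j`. [this work] -/
theorem bits_pt (j : ℕ) : bits (pt 3 j) = fun i : Fin 3 => j.testBit i := by
  funext i; simp [bits, pt]

/-- `code (pt 3 j) = j` for `j < 8`. [this work] -/
theorem code_pt {j : ℕ} (hj : j < 8) : code (pt 3 j) = j := by
  rw [code, bits_pt]
  interval_cases j <;> decide

/-- Sums over the pattern cube are sums over the eight codes. [this work] -/
theorem sum_eq_sum_range (F : Set (Fin 3) → ℝ) : ∑ S, F S = ∑ j ∈ range 8, F (pt 3 j) := by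
  exact sum_nbij' (fun S => code S) (fun j => pt 3 j) (fun S _ => mem_range.2 (code_lt S)) (fun j _ => mem_univ _)
    (fun S _ => pt_code S) (fun j hj => code_pt (mem_range.1 hj)) (fun S _ => by rw [pt_code])

/-! ### Bitmask events -/

/-- The event of patterns whose code is a set bit of `M`. [this work] -/
def HkM (M : ℕ) : Set (Set (Fin 3)) := {S | M.testBit (code S) = true}

/-- Membership in `HkM`. [this work] -/
theorem mem_HkM {M : ℕ} {S : Set (Fin 3)} : S ∈ HkM M ↔ M.testBit (code S) = true := Iff.rfl

/-- The table of `HkM M ∩ 𝒴` is the product table. [this work] -/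
theorem tabR_encA_HkM_inter (M : ℕ) (𝒴 : Set (Set (Fin 3))) : tabR 3 (encA 3 (HkM M ∩ 𝒴)) = tabR 3 (M &&& encA 3 𝒴) := by
  rw [tabR_land]
  funext g
  simp only [tabR]
  rw [tabZ_encA, tabZ_encA, tabZ_apply]
  simp only [Set.mem_inter_iff, mem_HkM, code_setOf]
  by_cases h1 : M.testBit (enc2 g) = true <;> by_cases h2 : {i | g i = true} ∈ 𝒴 <;> simp [h1, h2]

/-- The table of `HkM M` is the table of `M`. [this work] -/
theorem tabR_encA_HkM (M : ℕ) : tabR 3 (encA 3 (HkM M)) = tabR 3 M := by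
  funext g
  simp only [tabR]
  rw [tabZ_encA, tabZ_apply]
  simp only [mem_HkM, code_setOf]

/-- `HkM` of an increasing bitmask is an up-set: membership along `S ⊆ T` for the two masks used. [this work] -/
theorem isUpperSet_HkM_of {M : ℕ} (h : ∀ i < 8, ∀ j < 8, (∀ k < 3, i.testBit k = true → j.testBit k = true) →
    M.testBit i = true → M.testBit j = true) : IsUpperSet (HkM M) := by
  intro S T hST hS
  rw [mem_HkM] at hS ⊢
  refine h _ (code_lt S) _ (code_lt T) (fun k hk hk1 => ?_) hS
  have h1 := (mem_iff_testBit_code S ⟨k, hk⟩).2 hk1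
  exact (mem_iff_testBit_code T ⟨k, hk⟩).1 (hST h1)

/-- The majority pattern event `{ab, ac, bc, abc}` is increasing. [this work] -/
theorem isUpperSet_HkM_232 : IsUpperSet (HkM 232) := isUpperSet_HkM_of (by decide)

/-- The `a ∨ bc` pattern event `{a, ab, ac, bc, abc}` is increasing. [this work] -/
theorem isUpperSet_HkM_234 : IsUpperSet (HkM 234) := isUpperSet_HkM_of (by decide)

/-- Complement of the majority pattern event: `{∅, a, b, c}`. [this work] -/
theorem compl_HkM_232 : (HkM 232)ᶜ = HkM 23 := by
  ext S
  simp only [Set.mem_compl_iff, mem_HkM]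
  have hc := code_lt S
  generalize code S = c at *
  interval_cases c <;> decide

/-- Complement of the `a ∨ bc` pattern event: `{∅, b, c}`. [this work] -/
theorem compl_HkM_234 : (HkM 234)ᶜ = HkM 21 := by
  ext S
  simp only [Set.mem_compl_iff, mem_HkM]
  have hc := code_lt S
  generalize code S = c at *
  interval_cases c <;> decide

/-! ### Probabilities as bitmask polynomials -/

section Pr

variable (q : Fin 3 → unitInterval)

/-- `pr q 𝒴 = mlT (encA 𝒴)`. [this work] -/
theorem pr_eq_mlT (𝒴 : Set (Set (Fin 3))) : pr q 𝒴 = mlT (encA 3 𝒴) (xq q) := by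
  rw [pr, ex_bernoulliWeight_ind, real_eq_ML_cube]; rfl

/-- Equal tables, equal polynomials. [this work] -/
theorem mlT_congr {A B : ℕ} (h : tabR 3 A = tabR 3 B) (x : Fin 3 → ℝ) : mlT A x = mlT B x := by
  unfold mlT; rw [h]

/-- Intersections. [this work] -/
theorem pr_inter (𝒳 𝒵 : Set (Set (Fin 3))) : pr q (𝒳 ∩ 𝒵) = mlT (encA 3 𝒳 &&& encA 3 𝒵) (xq q) := by
  rw [pr_eq_mlT]; exact mlT_congr (tabR_encA_inter 𝒳 𝒵) _

/-- Bitmask events. [this work] -/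
theorem pr_HkM (M : ℕ) : pr q (HkM M) = mlT M (xq q) := by
  rw [pr_eq_mlT]; exact mlT_congr (tabR_encA_HkM M) _

/-- Intersections with bitmask events. [this work] -/
theorem pr_HkM_inter (M : ℕ) (𝒴 : Set (Set (Fin 3))) : pr q (HkM M ∩ 𝒴) = mlT (M &&& encA 3 𝒴) (xq q) := by
  rw [pr_eq_mlT]; exact mlT_congr (tabR_encA_HkM_inter M 𝒴) _

/-- Intersections with bitmask events, two factors. [this work] -/
theorem pr_HkM_inter_inter (M : ℕ) (𝒳 𝒵 : Set (Set (Fin 3))) :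
    pr q (HkM M ∩ (𝒳 ∩ 𝒵)) = mlT (M &&& (encA 3 𝒳 &&& encA 3 𝒵)) (xq q) := by
  rw [pr_HkM_inter]
  refine mlT_congr ?_ _
  rw [tabR_land, tabR_land, tabR_encA_inter, tabR_land]

/-- The gate of `…SahiTransportCheck` on encoded events is the indicator of the pattern. [this work] -/
theorem gate_encA (𝒳 𝒵 : Set (Set (Fin 3))) {j : ℕ} (hj : j < 8) :
    (gate (encA 3 𝒳 &&& encA 3 𝒵) j : ℝ) = ind (𝒳 ∩ 𝒵) (pt 3 j) := by
  unfold gate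
  rw [Nat.testBit_land, testBit_encA, testBit_encA]
  have h8 : decide (j < 2 ^ 3) = true := by rw [decide_eq_true_eq]; norm_num; exact hj
  rw [h8, Bool.true_and, Bool.true_and]
  by_cases h1 : pt 3 j ∈ 𝒳 <;> by_cases h2 : pt 3 j ∈ 𝒵
  · rw [ind_of_mem (Set.mem_inter h1 h2)]; simp [h1, h2]
  · rw [ind_of_not_mem (fun h => h2 h.2)]; simp [h1, h2]
  · rw [ind_of_not_mem (fun h => h1 h.1)]; simp [h1, h2]
  · rw [ind_of_not_mem (fun h => h1 h.1)]; simp [h1, h2]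

/-! ### Point patterns: `bernoulliWeight q (pt 3 j)` and `mlT 2^j` are the same monomial -/

/-- The weight of a point pattern is the corner monomial of its bits. [this work] -/
theorem bernoulliWeight_pt (j : ℕ) : bernoulliWeight q (pt 3 j) = mono (xq q) (fun i : Fin 3 => j.testBit i) := by
  unfold bernoulliWeight weight mono xq
  refine prod_congr rfl fun i _ => ?_
  simp only [pt, Set.mem_setOf_eq]

/-- A bitmask whose table is a single corner has `mlT` equal to that corner's monomial. [this work] -/
theorem mlT_single (M : ℕ) (g₀ : Fin 3 → Bool) (h : ∀ g, tabZ 3 M g = if g = g₀ then 1 else 0) (x : Fin 3 → ℝ) :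
    mlT M x = mono x g₀ := by
  unfold mlT ML tabR
  simp only [h]
  rw [Finset.sum_eq_single g₀]
  · simp
  · intro g _ hg; simp [hg]
  · intro h0; exact absurd (mem_univ _) h0

/-- `mlT 2^j = w(pt 3 j)`-monomial, for the eight points. [this work] -/
theorem mlT_pow_eq_mono {j : ℕ} (hj : j < 8) (x : Fin 3 → ℝ) : mlT (2 ^ j) x = mono x (fun i : Fin 3 => j.testBit i) := by
  refine mlT_single (2 ^ j) _ (fun g => ?_) x
  revert g
  interval_cases j <;> decide

/-- The corner monomial of three bits, spelled out. [this work] -/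
theorem mono_three (x : Fin 3 → ℝ) (g : Fin 3 → Bool) :
    mono x g = (if g 0 then x 0 else 1 - x 0) * (if g 1 then x 1 else 1 - x 1) * (if g 2 then x 2 else 1 - x 2) := by
  unfold mono; rw [Fin.prod_univ_three]

/-- `w(pt 3 j) = mlT 2^j` at the parameters. [this work] -/
theorem bernoulliWeight_pt_eq_mlT {j : ℕ} (hj : j < 8) : bernoulliWeight q (pt 3 j) = mlT (2 ^ j) (xq q) := by
  rw [bernoulliWeight_pt, mlT_pow_eq_mono hj]

/-! ### Linear table identities -/

/-- Equal-as-sum tables give equal-as-sum polynomials. [this work] -/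
theorem mlT_eq_add {M A B : ℕ} (h : ∀ g, tabZ 3 M g = tabZ 3 A g + tabZ 3 B g) (x : Fin 3 → ℝ) : mlT M x = mlT A x + mlT B x := by
  unfold mlT
  rw [← ML_add]
  congr 1
  funext g
  simp only [tabR, h]
  push_cast
  ring

/-- `w{ab,ac,bc,abc} = w(ab) + w(ac) + w(bc) + w(abc)`. [this work] -/
theorem mlT_232 (x : Fin 3 → ℝ) : mlT 232 x = mlT 8 x + mlT 32 x + mlT 64 x + mlT 128 x := by
  rw [mlT_eq_add (M := 232) (A := 8) (B := 224) (by decide), mlT_eq_add (M := 224) (A := 32) (B := 192) (by decide),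
    mlT_eq_add (M := 192) (A := 64) (B := 128) (by decide)]
  ring

/-- `w{a,ab,ac,bc,abc} = p_a-part + w(bc)`: `mlT 234 = mlT 170 + mlT 64`. [this work] -/
theorem mlT_234 (x : Fin 3 → ℝ) : mlT 234 x = mlT 170 x + mlT 64 x :=
  mlT_eq_add (M := 234) (A := 170) (B := 64) (by decide) x

/-- `p_a = w(a) + w(ab) + w(ac) + w(abc)`: `mlT 170 = mlT 2 + mlT 8 + mlT 32 + mlT 128`. [this work] -/
theorem mlT_170 (x : Fin 3 → ℝ) : mlT 170 x = mlT 2 x + mlT 8 x + mlT 32 x + mlT 128 x := by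
  rw [mlT_eq_add (M := 170) (A := 2) (B := 168) (by decide), mlT_eq_add (M := 168) (A := 8) (B := 160) (by decide),
    mlT_eq_add (M := 160) (A := 32) (B := 128) (by decide)]
  ring

/-- `w{∅,a,b,c} = w(∅) + w(a) + w(b) + w(c)`: `mlT 23 = mlT 1 + mlT 2 + mlT 4 + mlT 16`. [this work] -/
theorem mlT_23 (x : Fin 3 → ℝ) : mlT 23 x = mlT 1 x + mlT 2 x + mlT 4 x + mlT 16 x := by
  rw [mlT_eq_add (M := 23) (A := 1) (B := 22) (by decide), mlT_eq_add (M := 22) (A := 2) (B := 20) (by decide),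
    mlT_eq_add (M := 20) (A := 4) (B := 16) (by decide)]
  ring

/-- `w{∅,b,c} = w(∅) + w(b) + w(c)`: `mlT 21 = mlT 1 + mlT 4 + mlT 16`. [this work] -/
theorem mlT_21 (x : Fin 3 → ℝ) : mlT 21 x = mlT 1 x + mlT 4 x + mlT 16 x := by
  rw [mlT_eq_add (M := 21) (A := 1) (B := 20) (by decide), mlT_eq_add (M := 20) (A := 4) (B := 16) (by decide)]
  ring

/-- `2 − θ = 1 + δ` for the majority pattern event. [this work] -/
theorem two_sub_pr_232 : 2 - pr q (HkM 232) = 1 + mlT 23 (xq q) := by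
  have h := pr_compl q (HkM 232)
  rw [compl_HkM_232, pr_HkM, pr_HkM] at h
  rw [pr_HkM]; linarith

/-- `2 − θ = 1 + δ` for the `a ∨ bc` pattern event. [this work] -/
theorem two_sub_pr_234 : 2 - pr q (HkM 234) = 1 + mlT 21 (xq q) := by
  have h := pr_compl q (HkM 234)
  rw [compl_HkM_234, pr_HkM, pr_HkM] at h
  rw [pr_HkM]; linarith

end Pr

end SahiJuntaSlotThree

end Summit.CriticalPhenomena.PercolationContinuityZ3.Theorems
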